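import Literature.NumberTheory.EllipticCurves.IsogenyDegree
import Literature.NumberTheory.EllipticCurves.DivisionPolynomialMultiplication
import Literature.NumberTheory.EllipticCurves.GaloisActionProofs
import HarnessLib

/-!
# The multiplication-by-`m` isogeny `[m] : E → E` (Silverman, *AEC*, III.4, Example 4.1)

Trunk T-ELLARITH (group G16); notion `cm_endomorphisms_isogeny`. A sibling *proofs* file of the
prelude `Literature.NumberTheory.EllipticCurves.Isogeny`: it constructs, for an elliptic curve
`E = W` over any field `K` and an integer `m ≠ 0`, the multiplication-by-`m` map `[m]` as a term
`WeierstrassCurve.Isogeny.zsmul W m hm : Isogeny W W` of the prelude structure — the endomorphism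
`P ↦ m • P` of `E(K̄)` (Mathlib's group law), which is

* *algebraic* in the prelude's sense (`isAlgebraicOn_zsmul`): it agrees with the rational map
  `(φₘ/ψₘ², ωₘ/ψₘ³)` (division polynomials; Silverman, *AEC*, Exercise 3.7(d), in the tree
  `WeierstrassCurve.Affine.Point.zsmul_some_eq_of_evalEval_ψ_ne_zero` of
  `DivisionPolynomialMultiplication`) at every point `P` with `m • P ≠ O`
  (`agreesWithRationalMapAt_zsmul`), i.e. off the finite set `E[m]`
  (`finite_torsionPoints_holds`, *AEC* III.6.4);
* `Γ_K`-equivariant (Galois acts by group automorphisms of `E(K̄)`);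
* of finite kernel `E[m]` (`Isogeny.ker_zsmul`), of order `m²` when `m ≠ 0` in `K`
  (`Isogeny.degree_zsmul`, from the tree's `card_torsionPoints_eq_sq_holds`, *AEC* III.6.4(b)).

The tree so far had the identity isogeny (`IsogenyIdProofs`), the `2`-isogenies
(`IsogenyTwoTorsionProofs`) and sums/negatives/composites of isogenies, but not `[m]`
(`lean search 'IsAlgebraicOn' --decl`, `zsmul`/`nsmul` isogeny: nothing). The file also records
the rational representation `zsmulRationalRep` and the resulting formulae
`[m]^* x = φₘ(x, y)/ψₘ(x, y)²`, `[m]^* y = ωₘ(x, y)/ψₘ(x, y)³` in `K̄(E)`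
(`Isogeny.pullbackX_zsmul`, `Isogeny.pullbackY_zsmul`, over `IsogenyDegree`'s `pullbackX/Y`),
which serve the degree computation `deg [m] = m²` and the factorisation of isogenies through
`[m]` (*AEC* III.4.11) in sibling files.

## Contents

* `WeierstrassCurve.univSpec W : ℤ[A₁, A₂, A₃, A₄, X, Y] →+* K̄[x, y]` (a real definition): the
  specialisation of the universal pointed-curve ring `Literature.NumberTheory.EllipticCurves.UnivEC.U` of
  `DivisionPolynomialMultiplication` to the coefficients of `W`, keeping `X, Y` as variables;
  `eval_univSpec` (its values are the specialisations `UnivEC.ev`), `eval_univSpec_ψ/φ/ω`.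
* `agreesWithRationalMapAt_zsmul`, `setOf_not_agreesWithRationalMapAt_zsmul_subset`,
  `finite_geomTorsion`, `isAlgebraicOn_zsmul`, `isAlgebraicOn_nsmul`.
* `Isogeny.zsmul W m hm`, `Isogeny.nsmul W m hm` (real definitions) with `zsmul_apply`,
  `nsmul_apply`, `ker_zsmul`, `degree_zsmul`; `zsmulRationalRep`, `Isogeny.pullbackX_zsmul`,
  `Isogeny.pullbackY_zsmul`.

## References

* [SilvermanAEC2009] J. H. Silverman, *The Arithmetic of Elliptic Curves*, 2nd ed., GTM 106,
  Springer 2009: III.4, Example 4.1 (`[m]` is an isogeny defined over `K`), Prop. III.4.2(a)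
  (`[m] ≠ [0]`), Cor. III.6.4(b) (`#E[m] = m²`), Exercise 3.7(d) (the formula for `[m]`).

## Design

`noncomputable section`, `open scoped Classical` (the prelude's conventions); deliberate
dot-notation extensions in `namespace WeierstrassCurve`, as in the prelude and its other proofs
files. `[m]` is indexed by `m : ℤ` (`Isogeny.zsmul`, covering `[-1]`) with the `ℕ`-version
`Isogeny.nsmul` as an abbreviation; the hypothesis `[W.IsElliptic]` is needed (for the cuspidal
cubic in characteristic `p ∣ m` the map `[m]` is zero, hence not `IsAlgebraicOn`).
-/

noncomputable section

open scoped Classical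

universe u

namespace WeierstrassCurve

open MvPolynomial geomPoints Literature.NumberTheory.EllipticCurves

variable {K : Type u} [Field K] (W : WeierstrassCurve K)

/-! ## The division polynomials as two-variable polynomials over `K̄` -/

/-- The specialisation `ℤ[A₁, A₂, A₃, A₄, X, Y] → K̄[x, y]` of the universal pointed-curve ring of
`DivisionPolynomialMultiplication` (`Literature.NumberTheory.EllipticCurves.UnivEC.U`) attached to `W`: `Aᵢ ↦ aᵢ` (the coefficients
of `W` in `K̄`), `X ↦ x`, `Y ↦ y`. It carries the universal division values `φₙ, ψₙ, ωₙ` to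
two-variable polynomials over `K̄` whose values at an affine point `(x₀, y₀)` of `E(K̄)` are
`φₙ(x₀, y₀)`, `ψₙ(x₀, y₀)`, `ωₙ(x₀, y₀)` (`eval_univSpec`). Silverman, *AEC*, Exercise 3.7.
[folklore] -/
def univSpec : UnivEC.U →+* MvPolynomial (Fin 2) (AlgebraicClosure K) :=
  MvPolynomial.eval₂Hom (Int.castRingHom _)
    ![C (W.baseChange (AlgebraicClosure K)).a₁, C (W.baseChange (AlgebraicClosure K)).a₂,
      C (W.baseChange (AlgebraicClosure K)).a₃, C (W.baseChange (AlgebraicClosure K)).a₄, X 0, X 1]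

/-- Evaluating `univSpec u` at `(x₀, y₀)` is the specialisation `ev E x₀ y₀ u` of
`DivisionPolynomialMultiplication` (`Aᵢ ↦ aᵢ`, `X ↦ x₀`, `Y ↦ y₀`). [folklore] -/
theorem eval_univSpec (u : UnivEC.U) (v : Fin 2 → AlgebraicClosure K) :
    MvPolynomial.eval v (W.univSpec u) =
      UnivEC.ev (W.baseChange (AlgebraicClosure K)) (v 0) (v 1) u := by
  have key : (MvPolynomial.eval v).comp W.univSpec =
      UnivEC.ev (W.baseChange (AlgebraicClosure K)) (v 0) (v 1) := by
    refine MvPolynomial.ringHom_ext (fun r ↦ by simp [univSpec, UnivEC.ev]) fun i ↦ ?_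
    fin_cases i <;> simp [univSpec, UnivEC.ev]
  exact RingHom.congr_fun key u

/-- `univSpec ψₙ` has the value `ψₙ(x₀, y₀)` (Mathlib's division polynomial of `E / K̄`) at a point
`(x₀, y₀)` of the curve. [folklore] -/
theorem eval_univSpec_ψ (n : ℤ) {x₀ y₀ : AlgebraicClosure K}
    (h : (W.baseChange (AlgebraicClosure K)).toAffine.Equation x₀ y₀) :
    MvPolynomial.eval ![x₀, y₀] (W.univSpec (UnivEC.ψ n)) =
      ((W.baseChange (AlgebraicClosure K)).ψ n).evalEval x₀ y₀ := by
  rw [eval_univSpec]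
  change UnivEC.ev (W.baseChange (AlgebraicClosure K)) x₀ y₀ (UnivEC.ψ n) = _
  rw [UnivEC.map_ψ, UnivEC.curve_map_ev h, UnivEC.ev_xU, UnivEC.ev_yU]

/-- `univSpec φₙ` has the value `φₙ(x₀, y₀)` at a point of the curve. [folklore] -/
theorem eval_univSpec_φ (n : ℤ) {x₀ y₀ : AlgebraicClosure K}
    (h : (W.baseChange (AlgebraicClosure K)).toAffine.Equation x₀ y₀) :
    MvPolynomial.eval ![x₀, y₀] (W.univSpec (UnivEC.φ n)) =
      ((W.baseChange (AlgebraicClosure K)).φ n).evalEval x₀ y₀ := by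
  rw [eval_univSpec]
  change UnivEC.ev (W.baseChange (AlgebraicClosure K)) x₀ y₀ (UnivEC.φ n) = _
  rw [UnivEC.map_φ, UnivEC.curve_map_ev h, UnivEC.ev_xU, UnivEC.ev_yU]

/-- `univSpec ωₙ` has the value `ωₙ(x₀, y₀) = ωEval E x₀ y₀ n` at `(x₀, y₀)`. [folklore] -/
theorem eval_univSpec_ω (n : ℤ) (x₀ y₀ : AlgebraicClosure K) :
    MvPolynomial.eval ![x₀, y₀] (W.univSpec (UnivEC.ω n)) =
      Affine.Point.ωEval (W.baseChange (AlgebraicClosure K)) x₀ y₀ n := by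
  rw [eval_univSpec]
  rfl

/-! ## `[m]` is algebraic -/

/-- **`[m]` agrees with `(φₘ/ψₘ², ωₘ/ψₘ³)` at every point `P` with `m • P ≠ O`** (Silverman, *AEC*,
Exercise 3.7(d): `[m]P = (φₘ(P)/ψₘ(P)², ωₘ(P)/ψₘ(P)³)`; the tree's
`WeierstrassCurve.Affine.Point.zsmul_some_eq_of_evalEval_ψ_ne_zero` together with
"`ψₘ(P) = 0 ↔ m • P = O`", `zsmul_some_eq_zero_iff`). [cite: SilvermanAEC2009, Exercise 3.7(d)] -/
theorem agreesWithRationalMapAt_zsmul {m : ℤ} {P : W.geomPoints} (hP : m • P ≠ 0) :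
    AgreesWithRationalMapAt W W (W.univSpec (UnivEC.φ m)) (W.univSpec (UnivEC.ψ m) ^ 2)
      (W.univSpec (UnivEC.ω m)) (W.univSpec (UnivEC.ψ m) ^ 3) (fun Q ↦ m • Q) P := by
  rcases P with _ | ⟨x₀, y₀, h⟩
  · exact absurd (smul_zero m) hP
  · have hψ : ((W.baseChange (AlgebraicClosure K)).ψ m).evalEval x₀ y₀ ≠ 0 := fun h0 ↦
      hP ((Affine.Point.zsmul_some_eq_zero_iff h m).mpr h0)
    obtain ⟨hns, e⟩ := Affine.Point.zsmul_some_eq_of_evalEval_ψ_ne_zero h hψ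
    rw [agreesWithRationalMapAt_iff]
    refine ⟨Affine.Point.some_ne_zero h, ?_, ?_, ?_⟩
    · simpa [map_pow, xy_some, eval_univSpec_ψ W m h.1] using pow_ne_zero 2 hψ
    · simpa [map_pow, xy_some, eval_univSpec_ψ W m h.1] using pow_ne_zero 3 hψ
    · simp only [map_pow, xy_some, eval_univSpec_ψ W m h.1, eval_univSpec_φ W m h.1,
        eval_univSpec_ω W m]
      exact ⟨hns, e⟩

/-- The exceptional set of the representation `(φₘ/ψₘ², ωₘ/ψₘ³)` of `[m]` is contained in the
`m`-torsion `E[m]`. [folklore] -/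
theorem setOf_not_agreesWithRationalMapAt_zsmul_subset (m : ℤ) :
    {P : W.geomPoints | ¬ AgreesWithRationalMapAt W W (W.univSpec (UnivEC.φ m))
      (W.univSpec (UnivEC.ψ m) ^ 2) (W.univSpec (UnivEC.ω m)) (W.univSpec (UnivEC.ψ m) ^ 3)
      (fun Q ↦ m • Q) P} ⊆ (geomTorsion W m : Set W.geomPoints) := by
  intro P hP
  by_contra hPm
  exact hP (agreesWithRationalMapAt_zsmul W fun h ↦ hPm ((mem_torsionPoints_iff _ _ P).mpr h))

/-- `E[m] = E(K̄)[m]` is finite for `E` elliptic and `m ≠ 0` (the tree's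
`finite_torsionPoints_holds`, Silverman, *AEC*, Cor. III.6.4). [cite: SilvermanAEC2009, Cor. III.6.4] -/
theorem finite_geomTorsion [W.IsElliptic] {m : ℤ} (hm : m ≠ 0) :
    (geomTorsion W m : Set W.geomPoints).Finite :=
  haveI : Finite (geomTorsion W m) := finite_torsionPoints_holds W (AlgebraicClosure K) hm
  Set.toFinite _

/-- **`[m]` is algebraic** for `E` elliptic and `m ≠ 0`: it agrees with the rational map
`(φₘ/ψₘ², ωₘ/ψₘ³)` off the finite set `E[m]` (Silverman, *AEC*, III.4, Example 4.1: "`[m]` is a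
morphism", here through Exercise 3.7(d)). [cite: SilvermanAEC2009, III.4 Example 4.1 and Exercise 3.7(d)] -/
theorem isAlgebraicOn_zsmul [W.IsElliptic] {m : ℤ} (hm : m ≠ 0) :
    IsAlgebraicOn W W fun Q ↦ m • Q :=
  ⟨_, _, _, _, (finite_geomTorsion W hm).subset (setOf_not_agreesWithRationalMapAt_zsmul_subset W m)⟩

/-- `[m]` for `m : ℕ`, `m ≠ 0`, is algebraic. [folklore] -/
theorem isAlgebraicOn_nsmul [W.IsElliptic] {m : ℕ} (hm : m ≠ 0) :
    IsAlgebraicOn W W fun Q ↦ m • Q := by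
  have h := isAlgebraicOn_zsmul W (Int.natCast_ne_zero.mpr hm)
  simp only [natCast_zsmul] at h
  exact h

/-! ## The isogeny `[m]` -/

/-- **The multiplication-by-`m` isogeny `[m] : E → E`** for an elliptic curve `E = W` over `K` and
an integer `m ≠ 0`, as a term of the prelude's `Isogeny W W`: the endomorphism `P ↦ m • P` of
`E(K̄)`, algebraic via `(φₘ/ψₘ², ωₘ/ψₘ³)` off `E[m]` (`isAlgebraicOn_zsmul`), `Γ_K`-equivariant
(Galois acts by group automorphisms), with finite kernel `E[m]`. Silverman, *AEC*, III.4,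
Example 4.1 ("if `E` is defined over `K`, then `[m]` is defined over `K`"; `[m] ≠ [0]`,
Prop. III.4.2(a)). [cite: SilvermanAEC2009, III.4 Example 4.1] -/
def Isogeny.zsmul [W.IsElliptic] (m : ℤ) (hm : m ≠ 0) : Isogeny W W where
  toAddMonoidHom := zsmulAddGroupHom m
  isAlgebraic := isAlgebraicOn_zsmul W hm
  equivariant σ P := (map_zsmul (DistribSMul.toAddMonoidHom W.geomPoints σ) m P).symm
  finite_ker := by
    refine (finite_geomTorsion W hm).subset fun P hP ↦ ?_
    exact (mem_torsionPoints_iff _ _ P).mpr hP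

/-- `[m]` acts as `P ↦ m • P` on `E(K̄)`. [folklore] -/
@[simp]
theorem Isogeny.zsmul_apply [W.IsElliptic] (m : ℤ) (hm : m ≠ 0) (P : W.geomPoints) :
    Isogeny.zsmul W m hm P = m • P :=
  rfl

/-- The kernel of `[m]` is the `m`-torsion `E[m]`. Silverman, *AEC*, III.4 (`E[m] = ker [m]`).
[folklore] -/
theorem Isogeny.ker_zsmul [W.IsElliptic] (m : ℤ) (hm : m ≠ 0) :
    (Isogeny.zsmul W m hm).toAddMonoidHom.ker = geomTorsion W m := by
  ext P
  exact (mem_torsionPoints_iff _ _ P).symm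

/-- **`#ker [m] = m²` when `m ≠ 0` in `K`**: the prelude's `Isogeny.degree` (`= #ker`, the separable
degree) of `[m]` is `m²` for `m` invertible in `K` (Silverman, *AEC*, Cor. III.6.4(b), in the tree
`card_torsionPoints_eq_sq_holds`). [cite: SilvermanAEC2009, Cor. III.6.4(b)] -/
theorem Isogeny.degree_zsmul [W.IsElliptic] (m : ℤ) (hm : (m : K) ≠ 0) :
    (Isogeny.zsmul W m (by rintro rfl; exact hm (by simp))).degree = m.natAbs ^ 2 := by
  have hmK : (m : AlgebraicClosure K) ≠ 0 := by
    intro h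
    apply hm
    have : algebraMap K (AlgebraicClosure K) (m : K) = 0 := by rwa [map_intCast]
    exact (map_eq_zero _).mp this
  have hm' : ((m.natAbs : ℕ) : AlgebraicClosure K) ≠ 0 := by
    intro h
    apply hmK
    rcases Int.natAbs_eq m with h2 | h2
    · rw [h2, Int.cast_natCast, h]
    · rw [h2, Int.cast_neg, Int.cast_natCast, h, neg_zero]
  have hT : geomTorsion W m = geomTorsion W (m.natAbs : ℤ) := by
    ext P
    change m • P = 0 ↔ (m.natAbs : ℤ) • P = 0
    rcases Int.natAbs_eq m with h2 | h2
    · rw [← h2]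
    · conv_lhs => rw [h2]
      rw [neg_smul, neg_eq_zero]
  rw [Isogeny.degree, Isogeny.ker_zsmul, hT]
  exact card_torsionPoints_eq_sq_holds W (AlgebraicClosure K) hm'

/-- The multiplication-by-`m` isogeny for `m : ℕ`, `m ≠ 0`. [folklore] -/
def Isogeny.nsmul [W.IsElliptic] (m : ℕ) (hm : m ≠ 0) : Isogeny W W :=
  Isogeny.zsmul W m (Int.natCast_ne_zero.mpr hm)

/-- `Isogeny.nsmul W m` acts as `P ↦ m • P`. [folklore] -/
@[simp]
theorem Isogeny.nsmul_apply [W.IsElliptic] (m : ℕ) (hm : m ≠ 0) (P : W.geomPoints) :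
    Isogeny.nsmul W m hm P = m • P := by
  simp [Isogeny.nsmul, natCast_zsmul]

/-! ## A rational representation of `[m]` and its pull-backs -/

/-- The rational representation `(φₘ, ψₘ², ωₘ, ψₘ³)` of `[m]` (exceptional set `⊆ E[m]`).
Silverman, *AEC*, Exercise 3.7(d). [folklore] -/
def zsmulRationalRep [W.IsElliptic] (m : ℤ) (hm : m ≠ 0) : RationalRep W W (Isogeny.zsmul W m hm) where
  P₁ := W.univSpec (UnivEC.φ m)
  Q₁ := W.univSpec (UnivEC.ψ m) ^ 2
  P₂ := W.univSpec (UnivEC.ω m)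
  Q₂ := W.univSpec (UnivEC.ψ m) ^ 3
  finite := (finite_geomTorsion W hm).subset (setOf_not_agreesWithRationalMapAt_zsmul_subset W m)

/-- **`[m]^* x = φₘ(x, y)/ψₘ(x, y)²` in `K̄(E)`.** Silverman, *AEC*, Exercise 3.7(d).
[cite: SilvermanAEC2009, Exercise 3.7(d)] -/
theorem Isogeny.pullbackX_zsmul [W.IsElliptic] (m : ℤ) (hm : m ≠ 0) :
    (Isogeny.zsmul W m hm).pullbackX =
      W.evalGeneric (W.univSpec (UnivEC.φ m)) / W.evalGeneric (W.univSpec (UnivEC.ψ m)) ^ 2 := by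
  rw [Isogeny.pullbackX_eq _ (W.zsmulRationalRep m hm), RationalRep.pullbackX]
  simp [zsmulRationalRep, map_pow]

/-- **`[m]^* y = ωₘ(x, y)/ψₘ(x, y)³` in `K̄(E)`.** Silverman, *AEC*, Exercise 3.7(d).
[cite: SilvermanAEC2009, Exercise 3.7(d)] -/
theorem Isogeny.pullbackY_zsmul [W.IsElliptic] (m : ℤ) (hm : m ≠ 0) :
    (Isogeny.zsmul W m hm).pullbackY =
      W.evalGeneric (W.univSpec (UnivEC.ω m)) / W.evalGeneric (W.univSpec (UnivEC.ψ m)) ^ 3 := by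
  rw [Isogeny.pullbackY_eq _ (W.zsmulRationalRep m hm), RationalRep.pullbackY]
  simp [zsmulRationalRep, map_pow]

end WeierstrassCurve
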